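import Mathlib.Analysis.InnerProductSpace.PiL2
import Mathlib.Topology.Sets.Opens
import Mathlib.Topology.Homeomorph.Lemmas
import Mathlib.Geometry.Manifold.SmoothEmbedding
import Mathlib.Geometry.Manifold.Instances.Real
import HarnessLib

-- provenance: harness21/H21/H21/Prelude/FourManM/LocallyFlat.lean @ ebc9bd5 (interim HEAD d8f2665); M5 mechanical rewrite
/-!
# Locally flat embeddings (trunk T-4MAN, outline item C14)

A topological embedding `f : X → Y` of a `k`-manifold into an `n`-manifold is *locally flat*
if every point of the image has a neighbourhood `U` in `Y` such that the pair
`(U, U ∩ f(X))` is homeomorphic to the standard pair `(ℝⁿ, ℝᵏ × {0})`.  Local flatness is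
the correct tameness hypothesis for codimension-`≥ 1` topological embeddings (it rules out
wild arcs and horned spheres) and is the setting of the topological Schoenflies theorem
(Brown 1960) and of topologically slice knots (Freedman–Quinn 1990, §9.3).

## Main definitions

* `Literature.euclideanInclusion k n : 𝔼 k → 𝔼 n`: the standard inclusion `ℝᵏ ↪ ℝⁿ`, padding with
  zeros in the last `n - k` coordinates (and truncating if `n < k`).
* `Literature.IsLocallyFlat k n f`: `f` is a topological embedding and around every image point there
  is an open set `U` and a homeomorphism `U ≃ₜ ℝⁿ` carrying `U ∩ range f` onto `ℝᵏ ⊆ ℝⁿ`.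

## Main statements

* `Literature.Topology.FourManifolds.isLocallyFlat_of_isSmoothEmbedding`: a smooth embedding of boundaryless manifolds
  modelled on `𝔼 k`, `𝔼 n` is locally flat (immersion charts / tubular neighbourhoods; sorried).
* `Literature.Topology.FourManifolds.isLocallyFlat_euclideanInclusion`: the model inclusion is locally flat (proved).

## Design choices

* Mathlib has `Topology.IsEmbedding` and `Manifold.IsSmoothEmbedding` but (grep, v4.32.0) no
  notion of local flatness or of pairs of charts; we define `IsLocallyFlat` directly via local
  pair charts `(ℝⁿ, ℝᵏ)`.  The dimensions `k n` are explicit arguments since `X`, `Y` are bare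
  topological spaces.
* Only the *interior* model pair `(ℝⁿ, ℝᵏ)` is used.  For manifolds with boundary one also needs
  half-space pairs `(ℝⁿ₊, ℝᵏ₊)`; this is **not covered** here.  Downstream (slice discs,
  `SliceRibbon`), properly embedded discs are handled by restricting to the open disc / using the
  product-neighbourhood formulation instead.
* `euclideanInclusion` is defined for all `k n` (truncation when `n < k`) to avoid a dependent
  signature; the lemmas needing `k ≤ n` take it as a hypothesis.

## References

* M. Brown, *A proof of the generalized Schoenflies theorem*, Bull. AMS 66 (1960).
* M. Freedman, F. Quinn, *Topology of 4-manifolds* (1990), §9.3.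
* R. Daverman, G. Venema, *Embeddings in Manifolds*, GSM 106 (2009), §1.
-/

open scoped Manifold ContDiff Topology
open Set

noncomputable section

namespace Literature.Topology.FourManifolds

local notation "𝔼 " n:arg => EuclideanSpace ℝ (Fin n)

/-! ## The standard inclusion `ℝᵏ ↪ ℝⁿ` -/

/-- The standard inclusion `ℝᵏ → ℝⁿ`, `x ↦ (x₀, …, x_{k-1}, 0, …, 0)` (zero padding in the last
coordinates; if `n < k` the vector is truncated).  This is the flat model for locally flat
embeddings, cf. Daverman–Venema, *Embeddings in Manifolds* (2009), §1.1. [folklore] -/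
def euclideanInclusion (k n : ℕ) : 𝔼 k → 𝔼 n :=
  fun x ↦ WithLp.toLp 2 fun i ↦ if h : (i : ℕ) < k then x ⟨i, h⟩ else 0

/-- Coordinates of `euclideanInclusion k n x` (Daverman–Venema 2009, §1.1). [cite: DavermanVenema2009, §1.1] -/
@[simp]
theorem euclideanInclusion_apply (k n : ℕ) (x : 𝔼 k) (i : Fin n) :
    euclideanInclusion k n x i = if h : (i : ℕ) < k then x ⟨i, h⟩ else 0 := rfl

/-- For `k ≤ n` the standard inclusion `ℝᵏ ↪ ℝⁿ` is injective (Daverman–Venema 2009, §1.1). [cite: DavermanVenema2009, §1.1] -/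
theorem euclideanInclusion_injective {k n : ℕ} (h : k ≤ n) :
    Function.Injective (euclideanInclusion k n) := by
  intro x y hxy
  ext i
  have := congrArg (fun v ↦ v (Fin.castLE h i)) hxy
  simpa using this

/-- The standard inclusion `ℝᵏ → ℝⁿ` is continuous (Daverman–Venema 2009, §1.1). [cite: DavermanVenema2009, §1.1] -/
@[fun_prop]
theorem continuous_euclideanInclusion (k n : ℕ) : Continuous (euclideanInclusion k n) := by
  refine (PiLp.continuous_toLp 2 _).comp ?_
  refine continuous_pi fun i ↦ ?_
  split_ifs with h
  · exact (PiLp.continuous_apply 2 _ _).comp continuous_id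
  · exact continuous_const

/-- For `k ≤ n` the standard inclusion `ℝᵏ ↪ ℝⁿ` preserves the Euclidean norm
(Daverman–Venema 2009, §1.1). [cite: DavermanVenema2009, §1.1] -/
theorem norm_euclideanInclusion {k n : ℕ} (h : k ≤ n) (x : 𝔼 k) :
    ‖euclideanInclusion k n x‖ = ‖x‖ := by
  obtain ⟨m, rfl⟩ := Nat.exists_eq_add_of_le h
  simp only [EuclideanSpace.norm_eq, Fin.sum_univ_add, euclideanInclusion_apply]
  congr 1
  simp

/-! ## Locally flat embeddings -/

/-- A map `f : X → Y` is a *locally flat* embedding of a `k`-dimensional object into an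
`n`-dimensional one if it is a topological embedding and every image point `f x` has an open
neighbourhood `U` with a homeomorphism `φ : U ≃ₜ ℝⁿ` such that `φ (U ∩ range f) = ℝᵏ ⊆ ℝⁿ`
(the image of `euclideanInclusion k n`).  Only the interior model pair `(ℝⁿ, ℝᵏ)` is used: for
manifolds with boundary one would also need half-space pairs, which are not covered here
(slice discs use the product-neighbourhood formulation instead).
Brown (1960); Freedman–Quinn (1990), §9.3; Daverman–Venema (2009), §1.1. [cite: Brown1960] -/
def IsLocallyFlat {X Y : Type*} [TopologicalSpace X] [TopologicalSpace Y] (k n : ℕ)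
    (f : X → Y) : Prop :=
  Topology.IsEmbedding f ∧ ∀ x : X, ∃ U : TopologicalSpace.Opens Y, f x ∈ U ∧
    ∃ φ : U ≃ₜ 𝔼 n, φ '' (Subtype.val ⁻¹' range f) = range (euclideanInclusion k n)

namespace IsLocallyFlat

variable {X Y Y' : Type*} [TopologicalSpace X] [TopologicalSpace Y] [TopologicalSpace Y']
  {k n : ℕ} {f : X → Y}

/-- A locally flat embedding is a topological embedding (by definition;
Daverman–Venema 2009, §1.1). [cite: DavermanVenema2009, §1.1] -/
theorem isEmbedding (hf : IsLocallyFlat k n f) : Topology.IsEmbedding f := hf.1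

/-- A locally flat embedding is continuous (Daverman–Venema 2009, §1.1). [cite: DavermanVenema2009, §1.1] -/
protected theorem continuous (hf : IsLocallyFlat k n f) : Continuous f := hf.1.continuous

/-- A locally flat embedding is injective (Daverman–Venema 2009, §1.1). [cite: DavermanVenema2009, §1.1] -/
protected theorem injective (hf : IsLocallyFlat k n f) : Function.Injective f := hf.1.injective

/-- The local pair chart at a point of a locally flat embedding
(Daverman–Venema 2009, §1.1). [cite: DavermanVenema2009, §1.1] -/
theorem exists_chart (hf : IsLocallyFlat k n f) (x : X) :
    ∃ U : TopologicalSpace.Opens Y, f x ∈ U ∧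
      ∃ φ : U ≃ₜ 𝔼 n, φ '' (Subtype.val ⁻¹' range f) = range (euclideanInclusion k n) :=
  hf.2 x

/-- Local flatness is invariant under post-composition with a homeomorphism of the target
(Daverman–Venema 2009, §1.1). [cite: DavermanVenema2009, §1.1] -/
theorem comp_homeomorph (hf : IsLocallyFlat k n f) (e : Y ≃ₜ Y') :
    IsLocallyFlat k n (e ∘ f) := by
  refine ⟨e.isEmbedding.comp hf.1, fun x ↦ ?_⟩
  obtain ⟨U, hxU, φ, hφ⟩ := hf.2 x
  refine ⟨e.opensCongr U, ?_, ?_⟩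
  · simpa [Homeomorph.opensCongr_apply] using hxU
  · let ψ : e.opensCongr U ≃ₜ U :=
      (e.symm.subtype (p := fun y ↦ y ∈ e.opensCongr U) (q := fun y ↦ y ∈ U)
        (fun y ↦ by simp [Homeomorph.opensCongr_apply]))
    refine ⟨ψ.trans φ, ?_⟩
    rw [show ⇑(ψ.trans φ) = φ ∘ ψ from rfl, Set.image_comp]
    convert hφ using 2
    ext ⟨y, hy⟩
    simp only [mem_image, mem_preimage, mem_range, Subtype.exists, Function.comp_apply]
    constructor
    · rintro ⟨y', hy', ⟨x', rfl⟩, h⟩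
      refine ⟨x', ?_⟩
      have := congrArg Subtype.val h
      simpa [ψ, Homeomorph.subtype] using this
    · rintro ⟨x', hx'⟩
      refine ⟨e y, by simpa [Homeomorph.opensCongr_apply] using hy, ⟨x', by simp [hx']⟩, ?_⟩
      ext
      simp [ψ, Homeomorph.subtype]

end IsLocallyFlat

/-- The model inclusion `ℝᵏ ↪ ℝⁿ` (`k ≤ n`) is locally flat, with the single global chart
`U = ℝⁿ`, `φ = id` (Daverman–Venema 2009, §1.1). [cite: DavermanVenema2009, §1.1] -/
theorem isLocallyFlat_euclideanInclusion {k n : ℕ} (h : k ≤ n) :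
    IsLocallyFlat k n (euclideanInclusion k n) := by
  refine ⟨?_, fun x ↦ ⟨⊤, trivial, Homeomorph.Set.univ (𝔼 n), ?_⟩⟩
  · -- a continuous injection with continuous left inverse (truncation) is an embedding
    refine Topology.IsEmbedding.of_leftInverse (f := euclideanInclusion n k) ?_
      (continuous_euclideanInclusion n k) (continuous_euclideanInclusion k n)
    intro x
    ext i
    simp [lt_of_lt_of_le i.isLt h]
  · ext v
    simp [Homeomorph.Set.univ, Equiv.Set.univ]

/-- A smooth embedding `f : M → N` of boundaryless smooth manifolds modelled on `ℝᵏ`, `ℝⁿ` is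
locally flat: the immersion charts (equivalently, a tubular neighbourhood) straighten `f(M)`
locally to `ℝᵏ ⊆ ℝⁿ`, and since `f` is a topological embedding the image has no other local
sheets.  Freedman–Quinn (1990), §9.3; Daverman–Venema (2009), §1.1; Hirsch, *Differential
Topology*, Ch. 4 (tubular neighbourhoods). [cite: FreedmanQuinn1990] -/
def isLocallyFlat_of_isSmoothEmbedding : Prop :=
  ∀ {k n : ℕ} {M N : Type*} [TopologicalSpace M] [ChartedSpace (𝔼 k) M] [IsManifold (𝓡 k) ∞ M] [TopologicalSpace N] [ChartedSpace (𝔼 n) N] [IsManifold (𝓡 n) ∞ N] {f : M → N} (hf : Manifold.IsSmoothEmbedding (𝓡 k) (𝓡 n) ∞ f),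
    IsLocallyFlat k n f

end Literature.Topology.FourManifolds
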